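import Summits.BirchSwinnertonDyer.BirchSwinnertonDyer.Theorems.ThetaPartnerAtTwoSignedControlAtTwoShaThreeBaseIndexTwo
import Literature.NumberTheory.EllipticCurves.KummerSequenceConnecting
import Literature.NumberTheory.GaloisRepresentations.ContinuousH2OrderTwoCriterion
import Literature.NumberTheory.GaloisRepresentations.ContinuousH1OrderTwo
import Literature.NumberTheory.GaloisRepresentations.AbsGaloisRestrictRealPlace
import Literature.NumberTheory.GaloisRepresentations.LocalGlobalCohomology
import HarnessLib

/-!
# K4 `SignedControlAtTwo`, base case of Milne I Thm. 4.10 (c)₃: real-place injectivity of `H³(F, T)` from the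
# norm statement «every real-trivial class of `H²(F, T)` is a corestriction from an index-`2` subgroup missed by
# the complex conjugations»

Route `ThetaPartnerAtTwo` (TP2), crux K4 `SignedControlAtTwo` (stmt-BirchSwinnertonDyer-20309), line `eulerchar` v12, stub
`stub_poitouTateThreeRealRat`; width seat `bsd-wall-tp2-p3-w2` gen 7 (`--supports stmt-BirchSwinnertonDyer-20309`, helper).
The lead's dévissage (`…ShaThreeAssembly.poitouTate_three_realPlaces_injective_of_devissage`) displays the CFT base case as the
binder `hbase`: for a number field `F` and a TRIVIAL discrete `Γ_F`-module `T` of order `2`, a class of `H³(F, T)` vanishing at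
every real place is `0`.  This file proves the H³-to-H² REDUCTION of that base case (unconditional):

* §1 (group level) `exists_eq_add_rho_of_rho_eq` — in the index-`2` induced module `M_G^S(T)` of a trivial module, an element
  fixed by some `σ₀ ∉ S` is a "norm" `y + σ₀ y` (take `y` = the indicator of `S`); hence (§2)
  `subsingleton_two_coind_toLocal_of_isReal` — **`H²(Γ_{F_w}, M_{Γ_F}^S(T)) = 0` at a real place `w` whose complex conjugation
  misses `S`** (the tree's order-`2` criterion `twoCocycleClass_eq_zero_of_twoCocycleNormDiag_eq`).
* §2 **`realThree_injective_of_range_cor`**: let `S ≤ Γ_F` be OPEN of index `2` with `cd₂(S) ≤ 2`, missed by the non-trivial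
  element of `Γ_{F_w}` at every real place `w` (think `S = Γ_{F(√-1)}`); if every class of `H²(F, T)` vanishing at all real places
  lies in `cor(H²(S, T))`, then every class of `H³(F, T)` vanishing at all real places is `0`.  Proof (the index-`2` Gysin sequence
  of `…ShaThreeBaseIndexTwo`): `res_S c = 0` (`cd₂(S) ≤ 2`), so `c = [z]` with `unit ∘ z = dỹ` (α1); `y = [norm ∘ ỹ] ∈ H²(F, T)`
  vanishes at each real `w` because `loc_w c = 0` and `H²(Γ_{F_w}, M^S(T)) = 0` (`twoCocycleClass_comp_eq_zero_of_conn` for the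
  localised sequence); so `y ∈ cor(H²(S, T))` by hypothesis, and `[z] = 0` by (α2).
* `realThree_eq_zero_of_groupCdLE` — the totally complex case needs no hypothesis (`cd₂(Γ_F) ≤ 2`, an input here).

HONEST FRAMING: THEOREMS ONLY (no definition, no named fact, no `sorry`).  What remains of `hbase` after this file is an H²
statement (every real-trivial class of `H²(F, μ₂)` is a norm from `F(√-1)`), attacked in the sibling files; closes no item by
itself; BSD is not proved by any of this.
References: [SerreGaloisCohomology1997] I §2.5, II §4.4 Prop. 13, II §6.1; [MilneADT2006] I Thm. 4.10 (c); [NeukirchSchmidtWingberg2008] I §3.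
-/

set_option autoImplicit false
-- the Theorems namespace of this sub repeats the summit name by design (D-0017 nested layout)
set_option linter.dupNamespace false

noncomputable section

open CategoryTheory Function NumberField Field
open _root_.TopRep _root_.ContRepresentation _root_.ContinuousCohomology
open Literature.NumberTheory.GaloisRepresentations

universe u

namespace Summit.BirchSwinnertonDyer.BirchSwinnertonDyer.Theorems.SignedEC.ShaThreeBase

/-! ## §1 Fixed elements of the index-`2` induced module are norms -/

section IndexTwoNorm

variable {G : Type u} [Group G] [TopologicalSpace G] [IsTopologicalGroup G] [CompactSpace G]
variable {S : Subgroup G}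
variable {T : Type u} [AddCommGroup T] [TopologicalSpace T] [DiscreteTopology T]
variable (ρ : ContinuousRep G ℤ T)

/-- **In `M_G^S(T)` (`S` open of index `2`, `T` trivial), an element fixed by some `σ₀ ∉ S` is `y + σ₀ y`**: the two cosets
`S`, `S σ₀⁻¹` carry the values `m(1) = m(σ₀⁻¹)`, and `y` = (indicator of `S`) · `m(1)` works.  This is `X^{σ₀} = (1 + σ₀) X`
for the regular representation of the group of order `2`, i.e. `H²(⟨σ₀⟩, M_G^S(T)) = 0`. [cite: SerreGaloisCohomology1997, I §2.5] -/
theorem exists_eq_add_rho_of_rho_eq (htriv : ∀ (x : G) (t : T), ρ x t = t) (hSo : IsOpen (S : Set G))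
    (hidx : S.index = 2) {σ₀ : G} (hσ₀ : σ₀ ∉ S) (m : coindModule (ρ.restrict (subgroupIncl S)))
    (hm : coindRep (ρ.restrict (subgroupIncl S)) σ₀ m = m) :
    ∃ y : coindModule (ρ.restrict (subgroupIncl S)), m = y + coindRep (ρ.restrict (subgroupIncl S)) σ₀ y := by
  classical
  set t : T := (m : C(G, T)) 1 with ht
  -- the indicator of `S` with value `t`
  have hcont : Continuous ((S : Set G).indicator (fun _ : G => t)) := by
    refine IsLocallyConstant.continuous ((IsLocallyConstant.iff_exists_open _).2 fun x => ?_)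
    by_cases hx : x ∈ S
    · refine ⟨S, hSo, hx, fun y hy => ?_⟩
      rw [Set.indicator_of_mem (show y ∈ (S : Set G) from hy), Set.indicator_of_mem (show x ∈ (S : Set G) from hx)]
    · refine ⟨(S : Set G)ᶜ, (Subgroup.isClosed_of_isOpen S hSo).isOpen_compl, hx, fun y hy => ?_⟩
      rw [Set.indicator_of_notMem (show y ∉ (S : Set G) from hy), Set.indicator_of_notMem (show x ∉ (S : Set G) from hx)]
  have hmem : (⟨_, hcont⟩ : C(G, T)) ∈ coindModule (ρ.restrict (subgroupIncl S)) := fun s x => by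
    change (S : Set G).indicator (fun _ => t) ((s : G) * x) = ρ (subgroupIncl S s) ((S : Set G).indicator (fun _ => t) x)
    rw [subgroupIncl_apply, htriv]
    by_cases hx : x ∈ S
    · rw [Set.indicator_of_mem (show x ∈ (S : Set G) from hx),
        Set.indicator_of_mem (show (s : G) * x ∈ (S : Set G) from S.mul_mem s.2 hx)]
    · rw [Set.indicator_of_notMem (show x ∉ (S : Set G) from hx),
        Set.indicator_of_notMem (show (s : G) * x ∉ (S : Set G) from fun h => hx ((Subgroup.mul_mem_cancel_left S s.2).1 h))]
  refine ⟨⟨_, hmem⟩, Subtype.ext (ContinuousMap.ext fun x => ?_)⟩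
  -- `m(σ₀⁻¹) = m(1)` from `σ₀ m = m`
  have h1 : (m : C(G, T)) σ₀⁻¹ = t := by
    have := congrArg (fun F : coindModule (ρ.restrict (subgroupIncl S)) => (F : C(G, T)) σ₀⁻¹) hm
    change (m : C(G, T)) (σ₀⁻¹ * σ₀) = (m : C(G, T)) σ₀⁻¹ at this
    rw [inv_mul_cancel] at this
    exact this.symm
  change (m : C(G, T)) x = (S : Set G).indicator (fun _ => t) x + (S : Set G).indicator (fun _ => t) (x * σ₀)
  by_cases hx : x ∈ S
  · rw [coind_apply_of_mem ρ htriv m hx, Set.indicator_of_mem (show x ∈ (S : Set G) from hx),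
      Set.indicator_of_notMem (show x * σ₀ ∉ (S : Set G) from fun h => hσ₀ ((Subgroup.mul_mem_cancel_left S hx).1 h)),
      add_zero]
  · rw [coind_apply_of_not_mem ρ htriv hidx hσ₀ m hx, h1, Set.indicator_of_notMem (show x ∉ (S : Set G) from hx),
      Set.indicator_of_mem (show x * σ₀ ∈ (S : Set G) from mul_mem_of_not_mem_of_index_two hidx hx hσ₀), zero_add]

end IndexTwoNorm

/-! ## §2 The reduction of the base case of 4.10 (c)₃ to the norm statement in `H²` -/

section NumberField

variable {F : Type} [Field F] [NumberField F]
variable {T : Type} [AddCommGroup T] [TopologicalSpace T] [DiscreteTopology T]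
variable (σT : DiscreteGaloisModule F T)

/-- **`H²(Γ_{F_w}, M_{Γ_F}^S(T)) = 0` at a real place `w` whose complex conjugation misses `S`** (`S` open of index `2`, `T`
trivial): `Γ_{F_w} = {1, s}` with `r_w(s) ∉ S`, every normalised diagonal `φ(s,s) - s φ(1,1)` is `s`-fixed
(`rho_twoCocycleNormDiag`), hence a norm `y + s y` (§1), and the order-`2` criterion
`twoCocycleClass_eq_zero_of_twoCocycleNormDiag_eq` applies. [cite: SerreGaloisCohomology1997, II §6.1] -/
theorem subsingleton_two_coind_toLocal_of_isReal (htriv : ∀ (x : absoluteGaloisGroup F) (t : T), σT x t = t)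
    (S : Subgroup (absoluteGaloisGroup F)) (hSo : IsOpen (S : Set (absoluteGaloisGroup F))) (hidx : S.index = 2)
    {w : InfinitePlace F} (hw : w.IsReal)
    (hreal : ∀ s : absoluteGaloisGroup w.Completion, s ≠ 1 → absGaloisRestrict F w.Completion s ∉ S) :
    haveI : DiscreteTopology (coindModule (σT.restrict (subgroupIncl S))) := discreteTopology_coind _
    Subsingleton (continuousCohomology 2
      (DiscreteGaloisModule.toLocal (coindRep (σT.restrict (subgroupIncl S)) : DiscreteGaloisModule F _)
        (Sum.inl w)).toTopRep) := by
  haveI : DiscreteTopology (coindModule (σT.restrict (subgroupIncl S))) := discreteTopology_coind _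
  haveI : CompactSpace (absoluteGaloisGroup w.Completion) := absoluteGaloisGroup_compactSpace _
  haveI := finite_absoluteGaloisGroup_completion_infinitePlace w
  have hG := natCard_absoluteGaloisGroup_completion_infinitePlace_le_two w
  obtain ⟨s, hs1, -⟩ := exists_ne_one_forall_eq_of_isReal hw
  have hss : s * s = 1 := mul_self_eq_one_of_natCard_le_two hG s
  -- work over `Γ_{F_w}` in the `w.Completion` spelling
  let X : TopRep ℤ (absoluteGaloisGroup w.Completion) :=
    (DiscreteGaloisModule.toLocal (coindRep (σT.restrict (subgroupIncl S)) : DiscreteGaloisModule F _) (Sum.inl w)).toTopRep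
  suffices hX : ∀ x : continuousCohomology 2 X, x = 0 by
    exact ⟨fun a b => (hX a).trans (hX b).symm⟩
  intro x
  obtain ⟨φ, rfl⟩ := twoCocycleClass_surjective X x
  have hfix : X.ρ s (twoCocycleNormDiag s φ) = twoCocycleNormDiag s φ := rho_twoCocycleNormDiag hss φ
  have hfix' : coindRep (σT.restrict (subgroupIncl S)) (absGaloisRestrict F w.Completion s) (twoCocycleNormDiag s φ) =
      twoCocycleNormDiag s φ := hfix
  obtain ⟨y, hy⟩ := exists_eq_add_rho_of_rho_eq σT htriv hSo hidx (hreal s hs1) _ hfix'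
  exact twoCocycleClass_eq_zero_of_twoCocycleNormDiag_eq hG hs1 φ (y := y) hy

omit [NumberField F] in
/-- **The totally complex / `cd₂ ≤ 2` case**: if `cd₂(Γ_F) ≤ 2` then `H³(F, T) = 0` for `T` with `2T = 0`, so every class is
`0`. [cite: SerreGaloisCohomology1997, II §4.4 Prop. 13] -/
theorem realThree_eq_zero_of_groupCdLE (h2 : ∀ t : T, 2 • t = 0) (hcd : GroupCdLE (absoluteGaloisGroup F) 2 2)
    (c : galoisCohomology σT 3) : c = 0 := by
  have hprim : IsPrimaryTorsion 2 T := fun t => ⟨1, by rw [pow_one]; exact h2 t⟩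
  exact @Subsingleton.elim _ (hcd T σT hprim (show 2 < 3 by norm_num)) _ _

/-- **Base case of Milne I Thm. 4.10 (c)₃, reduced to the norm statement.**  Let `T` be a discrete `Γ_F`-module with trivial
action and `2T = 0`, and `S ≤ Γ_F` an open subgroup of index `2` with `cd₂(S) ≤ 2` which contains no image of the non-trivial
element of `Γ_{F_w}`, `w` real (e.g. `S = Γ_{F(√-1)}`).  If every class of `H²(F, T)` vanishing at all real places lies in
`cor(H²(S, T))`, then every class of `H³(F, T)` vanishing at all real places is `0`.
[cite: MilneADT2006, Ch. I, Thm. 4.10 (c)] [cite: SerreGaloisCohomology1997, I §2.5] [cite: NeukirchSchmidtWingberg2008, I §3] -/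
theorem realThree_injective_of_range_cor (htriv : ∀ (x : absoluteGaloisGroup F) (t : T), σT x t = t) (h2 : ∀ t : T, 2 • t = 0)
    (S : Subgroup (absoluteGaloisGroup F)) [IsClosed (S : Set (absoluteGaloisGroup F))] [Fintype (absoluteGaloisGroup F ⧸ S)]
    (hSo : IsOpen (S : Set (absoluteGaloisGroup F))) (hidx : S.index = 2) (hcd : GroupCdLE S 2 2)
    (hreal : ∀ w : InfinitePlace F, w.IsReal →
      ∀ s : absoluteGaloisGroup w.Completion, s ≠ 1 → absGaloisRestrict F w.Completion s ∉ S)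
    (hnorm : ∀ y : galoisCohomology σT 2,
      (∀ w : InfinitePlace F, w.IsReal → galoisCohomology.localization σT (Sum.inl w) 2 y = 0) →
        y ∈ Set.range (cor S σT 2))
    (c : galoisCohomology σT 3)
    (hc : ∀ w : InfinitePlace F, w.IsReal → galoisCohomology.localization σT (Sum.inl w) 3 c = 0) : c = 0 := by
  classical
  haveI : DiscreteTopology (coindModule (σT.restrict (subgroupIncl S))) := discreteTopology_coind _
  -- notation
  set C : DiscreteGaloisModule F (coindModule (σT.restrict (subgroupIncl S))) := coindRep (σT.restrict (subgroupIncl S))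
    with hCdef
  set f : σT.toTopRep ⟶ C.toTopRep := unitCoind (S := S) σT with hfdef
  set g : C.toTopRep ⟶ σT.toTopRep := normCoind σT with hgdef
  have hSES : IsSES f g := isSES_unitCoind_normCoind σT htriv h2 hSo hidx
  -- Step 1: `res_S c = 0` since `cd₂(S) ≤ 2`
  have hprim : IsPrimaryTorsion 2 T := fun t => ⟨1, by rw [pow_one]; exact h2 t⟩
  have hres : resH S σT 3 c = 0 := by
    haveI := hcd T (σT.restrict (subgroupIncl S)) hprim (show 2 < 3 by norm_num)
    exact Subsingleton.elim _ _
  -- Step 2: `c = [z]` with `unit ∘ z = dỹ`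
  obtain ⟨yt, z, hz, hzc⟩ := exists_conn_eq_of_resH_three_eq_zero σT hSo c hres
  -- Step 3: `y = [norm ∘ ỹ]` vanishes at the real places
  let yN : contTwoCocycles σT.toTopRep := ⟨_, comp_mem_contTwoCocycles_of_conn hSES yt z hz⟩
  have hyreal : ∀ w : InfinitePlace F, w.IsReal →
      galoisCohomology.localization σT (Sum.inl w) 2 (twoCocycleClass _ yN) = 0 := by
    intro w hw
    let Fw := Place.Completion (K := F) (Sum.inl w)
    haveI : CompactSpace (absoluteGaloisGroup Fw) := absoluteGaloisGroup_compactSpace _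
    let r : absoluteGaloisGroup Fw →ₜ* absoluteGaloisGroup F := absGaloisRestrict F Fw
    -- the localised sequence and the localised cochains
    have hSESw : IsSES (DiscreteGaloisModule.resFieldHom Fw f) (DiscreteGaloisModule.resFieldHom Fw g) :=
      hSES.restrictField Fw
    let ytw : C(absoluteGaloisGroup Fw × absoluteGaloisGroup Fw, coindModule (σT.restrict (subgroupIncl S))) :=
      yt.comp ((r : C(absoluteGaloisGroup Fw, absoluteGaloisGroup F)).prodMap (r : C(absoluteGaloisGroup Fw, absoluteGaloisGroup F)))
    let zw : contThreeCocycles (DiscreteGaloisModule.toTopRep (σT.toLocal (Sum.inl w))) :=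
      contThreeCocycles.pullback r (X := σT.toTopRep) (Y := DiscreteGaloisModule.toTopRep (σT.toLocal (Sum.inl w)))
        (TopRep.ofHom ⟨ContinuousLinearMap.id ℤ T, fun _ => rfl⟩) z
    have hzw : ∀ a b e : absoluteGaloisGroup Fw, (DiscreteGaloisModule.resFieldHom Fw f).hom (zw.1 (a, b, e)) =
        dTwo (DiscreteGaloisModule.toTopRep (C.toLocal (Sum.inl w))) ytw a b e := fun a b e => by
      change f.hom (z.1 (r a, r b, r e)) = _
      rw [hz, dTwo_apply, dTwo_apply]
      change _ = C (r a) (yt (r b, r e)) - yt (r (a * b), r e) + yt (r a, r (b * e)) - yt (r a, r b)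
      rw [map_mul, map_mul]
      rfl
    -- `loc_w c = [z_w] = 0`
    have hconn : threeCocycleClass _ zw = 0 := by
      have h := hc w hw
      rw [← hzc] at h
      exact (map_threeCocycleClass _ _ _ z).symm.trans h
    -- `H²(Γ_{F_w}, M^S(T)) = 0`
    have h2w := subsingleton_two_coind_toLocal_of_isReal σT htriv S hSo hidx hw (hreal w hw)
    have key := twoCocycleClass_comp_eq_zero_of_conn hSESw ytw zw hzw hconn h2w
    have loc₂ : galoisCohomology.localization σT (Sum.inl w) 2 (twoCocycleClass _ yN) =
        twoCocycleClass (DiscreteGaloisModule.toTopRep (σT.toLocal (Sum.inl w)))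
          (contTwoCocycles.pullback r (X := σT.toTopRep) (Y := DiscreteGaloisModule.toTopRep (σT.toLocal (Sum.inl w)))
            (TopRep.ofHom ⟨ContinuousLinearMap.id ℤ T, fun _ => rfl⟩) yN) :=
      map_twoCocycleClass _ _ _ yN
    rw [loc₂]
    refine Eq.trans (congrArg _ (Subtype.ext (ContinuousMap.ext fun p => rfl))) key
  -- Step 4: the norm hypothesis and (α2)
  have hrange := hnorm _ hyreal
  have h0 := threeCocycleClass_conn_eq_zero_of_mem_range_cor σT hSES yt z hz hrange
  rw [← hzc]
  exact h0

end NumberField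

end Summit.BirchSwinnertonDyer.BirchSwinnertonDyer.Theorems.SignedEC.ShaThreeBase

end
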